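import Literature.NumberTheory.EllipticCurves.Kato2004.ZetaLineRankOneRigidityProofs
import Literature.NumberTheory.EllipticCurves.Kato2004.IwasawaCohomology
import HarnessLib

/-!
# Route ByReductionTypeAtTwo, crux `AdditiveRankZeroAtTwo` (stmt-BirchSwinnertonDyer-19098), child C4″ `AdditivePotMultOverKAtTwo`
# (stmt-BirchSwinnertonDyer-22618) — reading step T22 (b) of the four descent sockets ON THE PINNED `𝐇¹_Γ(T_pW)`: two `Λ`-adic
# classes of Kato's `𝐇¹_Γ` whose character values are proportional off a finite set of characters generate the same line at
# every height-one prime `𝔮 ∌ p` — a THEOREM modulo `Kato2004.thm12_4` (theorems only)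

Cell `bsd-2adic` (run/shared/lean/pub/bsd-2adic/), seat `bsd-2adic-addL2x` GEN 19 (repair-census entry R-B82 «kernel for the
socket content»). The four MEMO-tier descent sockets `AddKatoTwo.KatoDescentSocketAtTwoAdditiveNeg{One,Two}SplitTwist{,Reducible}`
(`…AdditiveKatoDescentSocketDefs.lean`, p733240; the last Summits-side non-print inputs of the crux's residual
`AddKatoTwo.additiveRankZeroAtTwo_of_residual_v12`, p739123) have as content the descent reading T1–T14 plus T22 (a)(b). Step
**T22 (b)** (module docstring of the Defs file; memo `addL2x/gen18/NOTE-T22-descent-socket-GEN18.md` §2) reads: in Kato's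
rank-one `𝐇'¹ = 𝐇¹_Γ(T₂W)` the transported zeta line `Z̃ = Λ·z̃` of the (IW_d) input and Kato's `Z = Λ·z(f_W)` of T1–T14
«agree at every height-one `𝔮 ∌ 2`», because both classes have `ψ`-components of `exp*` equal to `L(W, ψ, 1)` times ONE
period each (12.5 (1) for `f_W` at `ψ` and for `f_{W'}` at `ωψ`, `L(f_{W'}, ωψ, s) = L(f_W, ψ, s)`), non-zero for all but
finitely many `ψ` (Rohrlich = Kato 13.5 (2), arbitrary finite `S` — `2 ∣ N` included), so «`z̃ = c·z`, `c` constant, by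
Weierstrass preparation». The algebra and the `p`-adic analysis of that sentence are now the KERNEL theorem
`Kato2004.lengthAt_quotient_span_eq_of_characterValues_proportional` (`Kato2004/ZetaLineRankOneRigidityProofs.lean`, p740449:
rank-one rigidity, the cofinite uniqueness principle for bounded `ℂ_p`-series at the character points, constants are units
away from `p`). THIS FILE reads it on the PINNED Iwasawa cohomology `I : Kato2004.IwasawaH1Data W p κ γ` under the PRINT fact
`Kato2004.thm12_4` (Thm. 12.4 (2): `I.H` torsion-free of rank `1`), for EVERY elliptic `W/ℚ`, prime `p` and cyclotomic
`(κ, γ)`: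

* `AddKatoTwo.lengthAt_quotient_zetaLine_eq_of_characterValues` — two non-zero `z, z̃ ∈ I.H` with value functionals as in
  T22 (b) (semilinear through `χ`, non-zero on `z`, proportional by fixed `α, β ∈ ℂ_p^×`, off a finite set of characters)
  have `ℓ_𝔮(I.H/Λz̃) = ℓ_𝔮(I.H/Λz)` at every prime `𝔮 ∌ p` of `Λ`;
* `AddKatoTwo.lengthAt_le_quotient_zetaLine_iff_of_characterValues` — hence, for ANY `Λ`-module `M` (Kato's `𝐇²`, the
  package's `H2`), Conj. 12.10's inequality `ℓ_𝔮(M) ≤ ℓ_𝔮(I.H/Λz̃)` at such a `𝔮` holds iff it holds for `Λz` — the exact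
  shape in which T22 (b) converts the (IW_d)-side inequality at the exceptional prime `𝔮₀ = (5T+4)` (T22 (a)) into the input
  of step T3 for `Z(f_W)`.

WHAT REMAINS A READING in T22 (b) after this file (named precisely): the EXISTENCE of the value functionals — the
`χ`-components of Kato's dual exponential map on `𝐇¹_Γ(T₂W) ⊗ ℚ` at the layer of `χ` (Thm. 12.5 (1), p. 221, for `f_W` and for
`f_{W'}`; `Λ`-semilinearity through `χ` is the `Λ`-linearity of 12.5 (1)'s map composed with the `χ`-projection), their
non-vanishing on `z(f_W)` off a finite set (13.5 (2), p. 227) and the single period ratio `α/β` (only EVEN `ψ` occur on the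
`Γ`-tower). HONEST FRAMING (D-0036/D-0054): theorems only, conditional on `thm12_4` where stated; nothing about the sockets is
asserted or changed (they remain `@[conjecture]`, MEMO tier); closes nothing; nothing booked; BSD is not proved by any of this.

References: [Kato2004Asterisque] Thm. 12.4 (2) (p. 221), Thm. 12.5 (1)(2) (pp. 221–222), Conj. 12.10 (p. 224), 13.5 (2) (p. 227),
13.9 (pp. 229–230); [MazurTateTeitelbaum1986Invent] §I.12–I.14; [Washington1997] §7.1, §13.2; tree
`Kato2004/ZetaLineRankOneRigidityProofs.lean` (p740449), `Kato2004/IwasawaCohomology.lean` (`IwasawaH1Data`, `thm12_4`),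
`…Theorems/ByReductionTypeAtTwoAdditiveKatoDescentSocketDefs.lean` (T22), memo `run/shared/lean/pub/bsd-2adic/addL2x/VERDICT-19098-addL2x-GEN19.md`.
-/

set_option autoImplicit false
-- the summit's namespace `Summit.BirchSwinnertonDyer.BirchSwinnertonDyer` (Sub = Summit) trips `dupNamespace`
set_option linter.dupNamespace false

noncomputable section

open scoped Classical

namespace Summit.BirchSwinnertonDyer.BirchSwinnertonDyer.Theorems.AddKatoTwo

open Field WeierstrassCurve Literature.NumberTheory.EllipticCurves Literature.NumberTheory.EllipticCurves.Kato2004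

/-- **T22 (b) on the pinned `𝐇¹_Γ(T_pW)`, modulo Thm. 12.4 (2).** Let `W/ℚ` be elliptic, `p` prime, `(κ, γ)` a cyclotomic
`ℤ_p`-extension datum with topological generator, `I : Kato2004.IwasawaH1Data W p κ γ` the pinned Iwasawa cohomology and
`z, z̃ ∈ I.H` non-zero. Suppose that for every primitive character `χ` of `Γ` of `p`-power order whose point `χ(γ₀) − 1`
(`γ₀ = cyclotomicGenerator p`) lies outside a finite set `S ⊂ ℂ_p` there is an additive functional `v_χ : I.H → ℂ_p`,
`Λ`-semilinear through `χ`, with `v_χ(z) ≠ 0` and `α·v_χ(z̃) = β·v_χ(z)` for fixed `α, β ∈ ℂ_p^×`. Then, granted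
`Kato2004.thm12_4` (`I.H` torsion-free of rank `1`), `ℓ_𝔮(I.H/Λz̃) = ℓ_𝔮(I.H/Λz)` at every prime `𝔮 ∌ p` of `Λ`. One line
from `Kato2004.lengthAt_quotient_span_eq_of_characterValues_proportional` (p740449). Conditional on the print fact `h12`.
[cite: Kato2004Asterisque, Thm. 12.4 (2) (p. 221), Thm. 12.5 (1)(2) (pp. 221–222), 13.5 (2) (p. 227)]
[cite: MazurTateTeitelbaum1986Invent, §I.12–I.14] [cite: Washington1997, §7.1] -/
theorem lengthAt_quotient_zetaLine_eq_of_characterValues (h12 : Kato2004.thm12_4) (W : WeierstrassCurve ℚ) [W.IsElliptic]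
    (p : ℕ) [Fact p.Prime] [ContinuousSMul ℤ_[p] (W.tateModule p)] {κ : ZpExtension ℚ p} {γ : absoluteGaloisGroup ℚ}
    (hκ : κ.IsCyclotomic) (hγ : κ.IsTopGenerator γ) (I : Kato2004.IwasawaH1Data W p κ γ) {z z' : I.H} (hz : z ≠ 0)
    (hz' : z' ≠ 0) {α β : ℂ_[p]} (hα : α ≠ 0) (hβ : β ≠ 0) (S : Finset ℂ_[p])
    (hv : ∀ m : ℕ, 0 < m → ∀ χ : DirichletCharacter ℂ_[p] (p ^ m), χ.IsPrimitive → χ.Even →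
      (∃ j : ℕ, orderOf χ = p ^ j) → (χ (cyclotomicGenerator p : ZMod (p ^ m)) - 1) ∉ S →
      ∃ v : I.H →+ ℂ_[p],
        (∀ (a : IwasawaAlgebra p) (x : I.H), v (a • x) =
          (∑' i, ((algebraMap ℚ_[p] ℂ_[p]).comp (algebraMap ℤ_[p] ℚ_[p])) (PowerSeries.coeff i a) *
            (χ (cyclotomicGenerator p : ZMod (p ^ m)) - 1) ^ i) * v x) ∧
        v z ≠ 0 ∧ α * v z' = β * v z)
    (𝔮 : PrimeSpectrum (IwasawaAlgebra p)) (hp𝔮 : PowerSeries.C (p : ℤ_[p]) ∉ 𝔮.asIdeal) :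
    Module.lengthAt (IwasawaAlgebra p) (I.H ⧸ Submodule.span (IwasawaAlgebra p) {z'}) 𝔮 =
      Module.lengthAt (IwasawaAlgebra p) (I.H ⧸ Submodule.span (IwasawaAlgebra p) {z}) 𝔮 := by
  obtain ⟨-, ⟨htf, hrk⟩, -⟩ := h12 W p κ γ hκ hγ I
  haveI := htf
  exact Kato2004.lengthAt_quotient_span_eq_of_characterValues_proportional hrk.le hz hz' hα hβ S hv 𝔮 hp𝔮

/-- **The consumed shape: Conj. 12.10's inequality at `𝔮 ∌ p` against the line `Λz̃` iff against the line `Λz`.** Under the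
hypotheses of `lengthAt_quotient_zetaLine_eq_of_characterValues`, for ANY `Λ`-module `M` (Kato's `𝐇²_Γ(T_pW)`, or the `H2`
of the odd-branch descent package) and any prime `𝔮 ∌ p`: `ℓ_𝔮(M) ≤ ℓ_𝔮(I.H/Λz̃) ↔ ℓ_𝔮(M) ≤ ℓ_𝔮(I.H/Λz)`. This is how
T22 (b) hands the inequality obtained at the exceptional prime `𝔮₀ = (5T+4)` from (IW_d) (step T22 (a), for the transported
line `Z̃`) to step T3 of the descent (which is about Kato's `Z(f_W)`). Pure rewriting of the previous theorem.
[cite: Kato2004Asterisque, Conj. 12.10 (p. 224), Thm. 12.5 (3) and (12.5.1) (p. 222)] -/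
theorem lengthAt_le_quotient_zetaLine_iff_of_characterValues (h12 : Kato2004.thm12_4) (W : WeierstrassCurve ℚ)
    [W.IsElliptic] (p : ℕ) [Fact p.Prime] [ContinuousSMul ℤ_[p] (W.tateModule p)] {κ : ZpExtension ℚ p}
    {γ : absoluteGaloisGroup ℚ} (hκ : κ.IsCyclotomic) (hγ : κ.IsTopGenerator γ) (I : Kato2004.IwasawaH1Data W p κ γ)
    {z z' : I.H} (hz : z ≠ 0) (hz' : z' ≠ 0) {α β : ℂ_[p]} (hα : α ≠ 0) (hβ : β ≠ 0) (S : Finset ℂ_[p])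
    (hv : ∀ m : ℕ, 0 < m → ∀ χ : DirichletCharacter ℂ_[p] (p ^ m), χ.IsPrimitive → χ.Even →
      (∃ j : ℕ, orderOf χ = p ^ j) → (χ (cyclotomicGenerator p : ZMod (p ^ m)) - 1) ∉ S →
      ∃ v : I.H →+ ℂ_[p],
        (∀ (a : IwasawaAlgebra p) (x : I.H), v (a • x) =
          (∑' i, ((algebraMap ℚ_[p] ℂ_[p]).comp (algebraMap ℤ_[p] ℚ_[p])) (PowerSeries.coeff i a) *
            (χ (cyclotomicGenerator p : ZMod (p ^ m)) - 1) ^ i) * v x) ∧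
        v z ≠ 0 ∧ α * v z' = β * v z)
    (M : Type*) [AddCommGroup M] [Module (IwasawaAlgebra p) M]
    (𝔮 : PrimeSpectrum (IwasawaAlgebra p)) (hp𝔮 : PowerSeries.C (p : ℤ_[p]) ∉ 𝔮.asIdeal) :
    Module.lengthAt (IwasawaAlgebra p) M 𝔮 ≤
        Module.lengthAt (IwasawaAlgebra p) (I.H ⧸ Submodule.span (IwasawaAlgebra p) {z'}) 𝔮 ↔
      Module.lengthAt (IwasawaAlgebra p) M 𝔮 ≤
        Module.lengthAt (IwasawaAlgebra p) (I.H ⧸ Submodule.span (IwasawaAlgebra p) {z}) 𝔮 := by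
  rw [lengthAt_quotient_zetaLine_eq_of_characterValues h12 W p hκ hγ I hz hz' hα hβ S hv 𝔮 hp𝔮]

end Summit.BirchSwinnertonDyer.BirchSwinnertonDyer.Theorems.AddKatoTwo

end
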